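import Summits.Ventures.LatticeQCDFlow.Scaling.SweepSchemeSectorCeiling
import Summits.Ventures.LatticeQCDFlow.Scaling.SectorCountMixingFloor

/-!
HONEST FRAMING: exact (Metropolis-corrected) sampling algorithms for lattice gauge theory; figures
of merit are autocorrelation/cost numbers at stated couplings and volumes; no continuum-physics
claim.

# SweepSchemeMixingFloor — THE SWEEP INSTANCES OF THE REVERSIBILITY-FREE LINEAR LAW: WITH SECTOR-FROZEN COLD
# REPLICAS THE SWEEP KERNEL PRESERVES THE COLD LABELS, SO `t·Q + (1−t)·Swp` HAS `d(t') ≤ 1/4 ⇒ m̄ < 8t'(1−t)` AND THE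
# PRODUCTION COMPOSITION `Swp * Q` (sweep, then any swap pass) HAS `m̄ < 8t'` (lean-2 GEN-20, ours)

Venture-side (OURS).  Cell `lqcd-flow` (pub-lqcd), unit `pub-lqcd-lean-2-g20`, 2026-08-25.  Chapter H; corollaries
of `SectorCountMixingFloor` (drift calculus) for the sweep kernel of `SweepSchemeSectorCeiling`.  `m̄ = Σ_k μ_k(A)`;
`Q` is ANY row-stochastic exchange pass preserving the number of replicas in `A` (no reversibility).

* `sweepKernel_coldPreserving` — frozen cold updates (`M_k(u,v) ≠ 0 ⇒ (u ∈ A ↔ v ∈ A)`, `k ≠ 0`) make the sweep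
  keep every cold replica's sector label; `drift_sweepKernel_sectorCount` (`≤ 1`).
* **`sweepScheme_mixing_floor`** (mixture) and **`sweepThenExchange_mixing_floor`** (composition `Swp * Q`).

NOT CLAIMED: anything measured.  Literature grade (cell rule): corollary file; nothing cited as a fact; no new bib keys.
-/

noncomputable section

open Finset Function Matrix
open Literature.Probability.MarkovChains

namespace Summit.Ventures.LatticeQCDFlow.Scaling

variable {S : Type*} [Fintype S] [DecidableEq S] {K : ℕ} {μ : Fin (K + 1) → S → ℝ}
  {M : Fin (K + 1) → S → S → ℝ} {Q : Matrix (Fin (K + 1) → S) (Fin (K + 1) → S) ℝ}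

omit [Fintype S] [DecidableEq S] in
/-- **With sector-frozen cold updates the sweep keeps every cold replica's sector label.** [ours] -/
theorem sweepKernel_coldPreserving [Fintype S] [DecidableEq S] {A : Finset S}
    (hfrozen : ∀ k : Fin (K + 1), k ≠ 0 → ∀ u v, M k u v ≠ 0 → (u ∈ A ↔ v ∈ A)) (x y : Fin (K + 1) → S)
    (hxy : sweepKernel M x y ≠ 0) (k : Fin (K + 1)) (hk : k ≠ 0) : (y k ∈ A ↔ x k ∈ A) := by
  rw [sweepKernel_apply] at hxy
  have hk' : M k (x k) (y k) ≠ 0 := fun h => hxy (Finset.prod_eq_zero (mem_univ k) h)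
  exact (hfrozen k hk (x k) (y k) hk').symm

/-- **The sweep raises the sector count by at most one in expectation** (cold replicas frozen). [ours] -/
theorem drift_sweepKernel_sectorCount (hM : ∀ k, IsRowStochastic (M k)) {A : Finset S}
    (hfrozen : ∀ k : Fin (K + 1), k ≠ 0 → ∀ u v, M k u v ≠ 0 → (u ∈ A ↔ v ∈ A)) (x : Fin (K + 1) → S) :
    ∑ y, sweepKernel M x y * (∑ k, (if y k ∈ A then (1 : ℝ) else 0)) ≤ (∑ k, (if x k ∈ A then (1 : ℝ) else 0)) + 1 :=
  drift_coldPreserving_sectorCount (sweepKernel_isRowStochastic hM) (sweepKernel_coldPreserving hfrozen) x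

section Floors

variable (hμ : ∀ k x, 0 < μ k x) (hμ1 : ∀ k, ∑ u, μ k u = 1) {A : Finset S} {u₀ : S} (hu₀ : u₀ ∉ A)
  (hm : 16 ≤ ∑ k : Fin (K + 1), ∑ u ∈ A, μ k u) (hM : ∀ k, IsRowStochastic (M k)) (hQ : IsRowStochastic Q)
  (hQA : ∀ x y, Q x y ≠ 0 → ∑ k, (if y k ∈ A then (1 : ℝ) else 0) = ∑ k, (if x k ∈ A then (1 : ℝ) else 0))
  (hfrozen : ∀ k : Fin (K + 1), k ≠ 0 → ∀ u v, M k u v ≠ 0 → (u ∈ A ↔ v ∈ A))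
include hμ hμ1 hu₀ hm hM hQ hQA hfrozen

/-- **THE SWEEP SCHEME, ANY EXCHANGE MOVE, NO REVERSIBILITY: `d(t') ≤ 1/4 ⇒ m̄ < 8·t'·(1−t)`** (`0 ≤ t ≤ 1`) — with
`μ_k(A) ≥ a`, more than `(K+1)a/(8(1−t))` sweeps. [ours] -/
theorem sweepScheme_mixing_floor {t : ℝ} (ht0 : 0 ≤ t) (ht1 : t ≤ 1) {t' : ℕ}
    (ht' : worstTvDist (fun x y : Fin (K + 1) → S => t * Q x y + (1 - t) * sweepKernel M x y) (tensorFun μ) t'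
      ≤ 1 / 4) :
    ∑ k : Fin (K + 1), ∑ u ∈ A, μ k u < 8 * t' * (1 - t) := by
  have h := sectorCount_mixing_floor hμ hμ1 hu₀ hm (sweepScheme_isRowStochastic hQ hM ht0 ht1)
    (fun x => drift_mixture ht0 ht1 (drift_exchange_sectorCount hQ hQA) (drift_sweepKernel_sectorCount hM hfrozen) x) ht'
  simpa using h

/-- **SWEEP, THEN ANY SWAP PASS (the production composition `Swp * Q`): `d(t') ≤ 1/4 ⇒ m̄ < 8·t'`.** [ours] -/
theorem sweepThenExchange_mixing_floor {t' : ℕ}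
    (ht' : worstTvDist (sweepKernel M * Q) (tensorFun μ) t' ≤ 1 / 4) : ∑ k : Fin (K + 1), ∑ u ∈ A, μ k u < 8 * t' :=
  coldPreservingScheme_mixing_floor hμ hμ1 hu₀ hm (sweepKernel_isRowStochastic hM) hQ (sweepKernel_coldPreserving hfrozen)
    hQA ht'

end Floors

end Summit.Ventures.LatticeQCDFlow.Scaling

end
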